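import Literature.AlgebraicGeometry.Motives.AlgPointsSeparate
import HarnessLib

/-!
# Every connected component of a scheme locally of finite type over a field carries an `Ω`-valued point, `Ω ⊇ K` algebraically closed
# ([GortzWedhorn2020] Prop. 3.35 (closed points are very dense); [StacksProject, Tag 01TB]; [MumfordAV1970] §4)

Layer `Literature/AlgebraicGeometry/Motives`, namespace `Literature.AlgebraicGeometry.Motives`.  THEOREMS ONLY (no definition, no named fact, no
instance, no `sorry`).  Cell `hodgecm-mathlib` (D-0151), P6 «MOD programme» (crux hLiu418 = `stmt-HodgeConjecture-24832`, `--supports`, count-neutral):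
the «ONE field point per connected component» input of the pointwise-to-global principles ★ `AbelianSchemeOver.eq_of_forall_exists_fieldPoint` ∕
`rosati_of_forall_exists_fieldPoint` (`RingActionOfPointwiseIdentities`, [Kottwitz1992] §5) and ★ `AbelianSchemeEndomorphismComplexDescent`, for a
`K`-scheme `X` locally of finite type and any algebraically closed `Ω ⊇ K` (e.g. the complex points of `X ⊗_{F} Fᵢ` along `τE : Fᵢ → ℂ`).
HC_CM is proved only modulo the 2 remaining named inputs (hLiu418 24832, h413 24833) until rung 0 closes; nothing here is about HC.

THE MATHEMATICS.  `X` is Jacobson (locally of finite type over a field), so the irreducible closed set `cl{x₀}` contains a closed point `y`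
([GortzWedhorn2020] Prop. 3.35); `cl{x₀}` is connected and contains `x₀`, so `y ∈` the connected component of `x₀`; and through a closed point
of a `K`-scheme locally of finite type passes an `Ω`-point over `K` (`κ(y)/K` is finite, ★ `exists_point_through_closedPoint`).

* `exists_algPoint_base_mem_connectedComponent` — for every `x₀ ∈ X` there is `P ∈ X(Ω)` whose image lies in the connected component of `x₀`.

## References
* [GortzWedhorn2020] U. Görtz, T. Wedhorn, *Algebraic Geometry I* (2nd ed.), Prop. 3.35.
* [StacksProject] The Stacks Project, Tag 01TB (points of schemes locally of finite type over a field), Tag 005E (closure of a connected set).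
* [MumfordAV1970] D. Mumford, *Abelian Varieties* (1970), §4.
-/

set_option autoImplicit false

noncomputable section

universe u

open CategoryTheory AlgebraicGeometry TopologicalSpace

namespace Literature.AlgebraicGeometry.Motives

variable {K : Type u} [Field K] (X : SchemeOver K) (Ω : Type u) [Field Ω] [Algebra K Ω] [IsAlgClosed Ω]

/-- **Every connected component of a `K`-scheme locally of finite type carries an `Ω`-valued point (`Ω ⊇ K` algebraically closed)**: for
every `x₀ ∈ X` there is `P ∈ X(Ω)` whose underlying point of `X` lies in the connected component of `x₀` — a closed point of the connected
closed set `cl{x₀}` ([GortzWedhorn2020] Prop. 3.35: `X` is Jacobson) and an `Ω`-point through it (★ `exists_point_through_closedPoint`).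
[cite: GortzWedhorn2020, Prop. 3.35] [cite: StacksProject, Tag 01TB] -/
theorem exists_algPoint_base_mem_connectedComponent [LocallyOfFiniteType X.hom] (x₀ : X.left) :
    ∃ P : AlgPoints X Ω, P.left.base (IsLocalRing.closedPoint Ω) ∈ connectedComponent x₀ := by
  haveI : JacobsonSpace X.left := LocallyOfFiniteType.jacobsonSpace X.hom
  -- a closed point `y` in the closure of `{x₀}`
  obtain ⟨y, hy₀, hy⟩ := nonempty_inter_closedPoints (Z := closure ({x₀} : Set X.left)) ⟨x₀, subset_closure rfl⟩
    isClosed_closure.isLocallyClosed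
  have hyc : IsClosed ({y} : Set X.left) := mem_closedPoints_iff.1 hy
  -- an `Ω`-point over `K` through `y`
  obtain ⟨τ, hτ⟩ := exists_point_through_closedPoint X.hom Ω hyc
  refine ⟨Over.homMk (Spec.map τ ≫ X.left.fromSpecResidueField y) hτ, ?_⟩
  have hbase : (Spec.map τ ≫ X.left.fromSpecResidueField y).base (IsLocalRing.closedPoint Ω) = y := by
    show (X.left.fromSpecResidueField y).base ((Spec.map τ).base (IsLocalRing.closedPoint Ω)) = y
    exact X.left.fromSpecResidueField_apply y _
  show (Spec.map τ ≫ X.left.fromSpecResidueField y).base (IsLocalRing.closedPoint Ω) ∈ connectedComponent x₀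
  rw [hbase]
  -- `cl{x₀}` is connected and contains `x₀` and `y`
  exact isPreconnected_singleton.closure.subset_connectedComponent (subset_closure rfl) hy₀

end Literature.AlgebraicGeometry.Motives

end
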